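import Mathlib
import Literature.MathematicalPhysics.QuantumFieldTheory.Balaban1983to89.B15TouchingCubeContours

/-!
# `Balaban1983to89.B15TouchingCubeDomains` — the DOMAIN CLASSES on which every hypothesis of the touching-cube chain
# (`B15TouchingCubeContours` → `B6Ineq261LevelGap` → `B6Lemma21Repaired`) is a theorem: (A) the complements of ANY
# [Balaban1988Convergent] (2.13)-admissible sequence of domains completed to the whole lattice ([Balaban1984PropagatorsII]
# (2.1)–(2.4), [Balaban1989LargeFieldI] p. 179), and (B) a CONCRETE one, concentric boxes — Lemma 2.1 (2.60)–(2.63)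
# [Balaban1984PropagatorsII] for the touching-cube geometry over them with every geometric hypothesis DISCHARGED

statement-level skeleton of published theorems with citation tags; proofs where landed; nothing here is a claim about
the Yang–Mills mass gap

CITATION HEADER.  T. Bałaban, *Propagators and renormalization transformations for lattice gauge theories. II*, Commun. Math.
Phys. **96** (1984) 223–250 [Balaban1984PropagatorsII] (cell paper B6; (2.1)–(2.4) p. 224 = PDF 2, Lemma 2.1 p. 234 = PDF 12;
PDF held `paper:balaban1984-cmp96-propagators-rt-ii`), T. Bałaban, *Convergent renormalization expansions for lattice gauge
theories*, Commun. Math. Phys. **119** (1988) 243–285 [Balaban1988Convergent] (cell paper B14 = [III]; (2.13) p. 256 = PDF 14),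
T. Bałaban, *Large field renormalization. I*, Commun. Math. Phys. **122** (1989) 175–202 [Balaban1989LargeFieldI] (cell paper
B15 = [IV]; p. 179 = PDF 5, p. 186 = PDF 12; PDF held `paper:balaban1989-cmp122-large-field-i`).
WHAT IS REPRODUCED: rows **B6.Lem2.1** (owner r03; Lemma 2.1 on model classes), **B14.Eq2.13** (owner r11; the admissible
sequences as the carrier), the cube model of **B15.Eq1.47**/p. 179 (owner r12).  (A) is print's own class: [III] p. 256
*«a sequence of maximal domains Ω = Ω₀ ⊃ Ω₁ ⊃ … ⊃ Ω_j such that Ω_n is a union of LⁿξM₁-cubes, and dist(Ω_n, Ω^c_{n−1}) ≧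
LⁿξM₁»* (typed by r11 as the separation property `x ∈ Ω_{n+1} → Within (s_{n+1} − 1) x y → y ∈ Ω_n`, `s_n = side L M n`), [IV]
p. 179 *«the complements of these sets form an admissible sequence of domains based on partitions into M-cubes in the
corresponding scales»*, [B6] p. 224 *«Ω₁ ⊃ Ω₂ ⊃ … ⊃ Ω_k, Ω_j ⊂ T_η (2.1) … T = ⋃_{j=0}^k B^j(Λ_j) (2.4) … we admit the case when
some domains Ω_j are equal to T_η»* (here: `Ω₀ = T`, and the sequence ends, `Ω_n = ∅` eventually, so that the layers cover
`T`); (B) is a MODEL INSTANCE (ours, in the sense of `B6CoverBox.boxGeo` / `B6LevelGapMetric` §3) exhibiting joint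
satisfiability with a non-trivial level gap.  Mega-formalization `lit-balaban`, HOME `run/shared/lean/pub/lit-balaban/`;
Phase-2 proof seat p29 gen 11 (unit `lit-balaban-p29`, free-target protocol G.5-34(d)).  Used BY NAME: `B15Ineq147LevelGap.{toR,
cube, CubeSite, LayerSepZd}`, `B15Ineq147Admissible.{monotone_compl_of_admissible, layerSepZd_of_admissible}` (p29 g8),
`B14DomainGeom.{cubeIdx, IsUnionOfCubes, Within}`, `B14.Eq213MaximalDomains.side` (r11), `B15TouchingCubeContours.{touchC, Tiles,
tiles_of_layers, cover_of_exhaustive, layers_of_partitions, touchC_connected, levelGap_touchC_sharp, touchGeo, rowSum_touchGeo,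
lemma21_touchGeo}` (p29 g11), `B6Ineq261LevelGap.K261` (p29 g10).

(A) THE ADMISSIBLE CLASS (dictionary of `B15Ineq147Admissible`: finest lattice `ℤᵈ`, η = 1, scales from the bottom, partition
cubes of side `M·Lⁿ` — r11's `side L M n` —, bond cubes of side `M₁Lⁿ`, `M₁ ∣ M`; `Z″_n := (Ω_n)ᶜ`).  Hypotheses: r11's
separation property `hdistD`, *«Ω_n is a union of LⁿξM₁-cubes»* (`hcubes : IsUnionOfCubes (side L M n) (Ω_n)`), `Ω₀ = T`
(`h0`), and termination `∀ x ∃ n, x ∉ Ω_n` (`hex`).  Conclusions: `Tiles M₁ L Z″` (`tiles_of_admissible`), hence (2.61) /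
Lemma 2.1 for `touchGeo M₁ L Z″ F …` (`rowSum_admissible`, `lemma21_admissible`) with the numerics only.
(B) THE NESTED BOXES.  Parameters `M₁ ≥ 1`, `K ≥ 1` (the separation count, print's `M/M₁` with `M = M₁·K`), `L ≥ 1`, `d ≥ 1`;
`Z″_n := {x ∈ ℤᵈ | ∀ μ, −r_n ≤ x_μ < r_n}`, `r_n = M₁·K·n·Lⁿ`: `Z″_0 = ∅`, the boxes increase and exhaust `ℤᵈ`, `r_n`, `r_{n+1}`
are multiples of `M₁Lⁿ` (the layer `Z″_{n+1}∖Z″_n` is a union of `M₁Lⁿ`-cubes), and `r_{n+1} − r_n ≥ M₁K·L^{n+1}` (one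
separating layer of `M·L^{n+1}`-cubes).

WHAT THIS FILE PROVES (kernel-checked, zero `sorry`; three definitions with bodies (`box`, `boxR`, `nestedZ`); no named fact;
axioms standard).  §1 `box`, `mem_box_iff_cubeIdx`, `isUnionOfCubes_box`, `isUnionOfCubes_diff`; §2 (A): `compl_layer`,
`layers_of_admissibleCubes`, **`tiles_of_admissible`**, **`rowSum_admissible`**, **`lemma21_admissible`** (Lemma 2.1 (2.60)–(2.63)
for the touching-cube geometry over the complements of any admissible sequence with `Ω₀ = T` that terminates: hypotheses = r11's
admissibility data + numerics); §3 (B): `boxR`, `nestedZ`, `boxR_step`, `boxR_mono`, `box_mono`, **`monotone_nestedZ`**,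
**`layerSepZd_nestedZ`** (`LayerSepZd (nestedZ M₁ K L) (M₁·K) L`), `layers_nestedZ`, `nestedZ_zero`, `exhaustive_nestedZ`,
**`tiles_nestedZ`**, `connected_nestedZ`, `levelGap_nestedZ` (`LevelGap … (L·K − 1)`); §4 **`rowSum_nestedBoxes`**,
**`lemma21_nestedBoxes`** — (2.61) and Lemma 2.1 for `touchGeo M₁ L (nestedZ M₁ K L) F …` on ANY finite set `F` of its cube-sites,
hypotheses ONLY numerical (`d, M₁, K ≥ 1`, `L ≥ 1`, `N ≥ 1`, `N + 1 ≤ L·K`, `R·M_r ≤ N`, `δ₀ ≥ 0`, `0 ≤ α ≤ 1`,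
`e^{−αδ₀}·L^{2d/N} < 1`).
HONEST SCOPE.  (A) is print's class in r11's typed reading, completed to the whole lattice as (2.1)/(2.4) [B6] require (the
completion data `h0`, `hex` are hypotheses); (B) is a synthetic instance; the contour reading and the `L`-dependent constant
are those of `B15TouchingCubeContours` / `B6Ineq261LevelGap` (their honest scopes apply).  NOT summit progress.
-/

namespace Literature.MathematicalPhysics.QuantumFieldTheory.Balaban1983to89.B15TouchingCubeDomains

open Literature.MathematicalPhysics.QuantumFieldTheory.Balaban1983to89
open B6Geometry B15Ineq147LevelGap B15Ineq147Admissible B14DomainGeom B6Ineq261LevelGap B11SectG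
  B15TouchingCubeContours

variable {d : ℕ}

/-! ## §1. Boxes aligned to a cube partition -/

/-- The box `{x ∈ ℤᵈ | ∀ μ, −r ≤ x_μ < r}` of half-width `r` (a rectangular parallelepiped of the lattice, the shape of the
regions of [IV] p. 179: *«all components of the domains Z″_j are also rectangular parallelepipeds»*). [cite: Balaban1989LargeFieldI, p.179] -/
def box (r : ℕ) : Set (Fin d → ℤ) := {x | ∀ μ, -(r : ℤ) ≤ x μ ∧ x μ < r}

/-- Membership in a box of half-width `s·t` depends only on the index of the side-`s` cube of the point: `x ∈ box (s·t)` iff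
`−t ≤ cubeIdx s x μ < t` for all `μ` (`s ≥ 1`). [cite: Balaban1989LargeFieldI, p.179] -/
theorem mem_box_iff_cubeIdx {s t : ℕ} (hs : 0 < s) (x : Fin d → ℤ) :
    x ∈ box (s * t) ↔ ∀ μ, -(t : ℤ) ≤ cubeIdx s x μ ∧ cubeIdx s x μ < t := by
  have hs' : (0 : ℤ) < s := by exact_mod_cast hs
  refine forall_congr' fun μ => ?_
  unfold cubeIdx
  rw [Int.le_ediv_iff_mul_le hs', Int.ediv_lt_iff_lt_mul hs']
  push_cast
  constructor <;> rintro ⟨h1, h2⟩ <;> constructor <;> linarith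

/-- A box of half-width `s·t` is a union of cubes of the side-`s` partition (*«unions of M-cubes of the lattice»*).
[cite: Balaban1989LargeFieldI, p.179] -/
theorem isUnionOfCubes_box {s : ℕ} (hs : 0 < s) (t : ℕ) : IsUnionOfCubes s (box (d := d) (s * t)) := by
  intro x y hxy
  rw [mem_box_iff_cubeIdx hs, mem_box_iff_cubeIdx hs, hxy]

/-- The difference of two unions of `s`-cubes is a union of `s`-cubes. [cite: Balaban1989LargeFieldI, p.179] -/
theorem isUnionOfCubes_diff {s : ℕ} {A B : Set (Fin d → ℤ)} (hA : IsUnionOfCubes s A) (hB : IsUnionOfCubes s B) :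
    IsUnionOfCubes s (A \ B) := fun x y hxy => by
  simp only [Set.mem_sdiff, hA x y hxy, hB x y hxy]

/-! ## §2. (A) The complements of an admissible sequence completed to the whole lattice -/

section Admissible

variable {L M M₁ : ℕ} {D : ℕ → Set (Fin d → ℤ)}

/-- A union of `s·t`-cubes is a union of `s`-cubes (nested partitions). [folklore] -/
private theorem isUnionOfCubes_of_mul {s t : ℕ} {Λ : Set (Fin d → ℤ)} (h : IsUnionOfCubes (s * t) Λ) :
    IsUnionOfCubes s Λ := by
  intro x y hxy
  apply h
  funext i
  have hi := congrFun hxy i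
  unfold cubeIdx at hi ⊢
  push_cast
  rw [← Int.ediv_ediv_of_nonneg (Int.natCast_nonneg s), ← Int.ediv_ediv_of_nonneg (Int.natCast_nonneg s), hi]

/-- The layers of the complements are the layers of the domains: `(Ω_{n+1})ᶜ∖(Ω_n)ᶜ = Ω_n∖Ω_{n+1}` ((2.3) *«Λ_j = Ω_j^{(j)}∖
Ω_{j+1}^{(j)}»*). [cite: Balaban1984PropagatorsII, (2.3) p.224] -/
theorem compl_layer (n : ℕ) : (D (n + 1))ᶜ \ (D n)ᶜ = D n \ D (n + 1) := by
  ext x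
  simp only [Set.mem_sdiff, Set.mem_compl_iff, not_not]
  exact and_comm

/-- *«Ω_n is a union of LⁿξM₁-cubes»* for every `n` (r11's `side L M n = Lⁿ·M`), `M₁ ∣ M` ⇒ the layers `Z″_{n+1}∖Z″_n = Ω_n∖Ω_{n+1}`
of the complements are unions of the bond cubes of side `M₁Lⁿ` (the hypothesis `hlayer` of `B15TouchingCubeContours.tiles_of_layers`).
[cite: Balaban1988Convergent, (2.13) p.256; Balaban1989LargeFieldI, p.179] -/
theorem layers_of_admissibleCubes (hdvd : M₁ ∣ M) (hcubes : ∀ n, IsUnionOfCubes (B14.Eq213MaximalDomains.side L M n) (D n)) :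
    ∀ n, IsUnionOfCubes (M₁ * L ^ n) ((fun m => (D m)ᶜ) (n + 1) \ (fun m => (D m)ᶜ) n) := by
  refine layers_of_partitions (Z := fun m => (D m)ᶜ) hdvd fun n => ?_
  have e0 : B14.Eq213MaximalDomains.side L M n = M * L ^ n := by
    unfold B14.Eq213MaximalDomains.side; ring
  have e1 : B14.Eq213MaximalDomains.side L M (n + 1) = M * L ^ n * L := by
    unfold B14.Eq213MaximalDomains.side; ring
  have h1 : IsUnionOfCubes (M * L ^ n) (D n) := e0 ▸ hcubes n
  have h2 : IsUnionOfCubes (M * L ^ n) (D (n + 1)) := isUnionOfCubes_of_mul (e1 ▸ hcubes (n + 1))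
  show IsUnionOfCubes (M * L ^ n) ((D (n + 1))ᶜ \ (D n)ᶜ)
  rw [compl_layer]
  exact isUnionOfCubes_diff h1 h2

/-- **The covering (2.4) for the complements of an admissible sequence**: if every `Ω_n` is a union of `LⁿM`-cubes (`M₁ ∣ M`),
`Ω₀ = T` and the sequence terminates (`∀ x ∃ n, x ∉ Ω_n`), then every lattice point lies in the cube of a cube-site of
`Z″ = Ωᶜ` (`M₁ ≥ 1`, `L ≥ 1`). [cite: Balaban1984PropagatorsII, (2.1)–(2.4) p.224; Balaban1988Convergent, (2.13) p.256; Balaban1989LargeFieldI, p.179] -/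
theorem tiles_of_admissible (hM₁ : 0 < M₁) (hL : 1 ≤ L) (hdvd : M₁ ∣ M)
    (hcubes : ∀ n, IsUnionOfCubes (B14.Eq213MaximalDomains.side L M n) (D n)) (h0 : D 0 = Set.univ) (hex : ∀ x, ∃ n, x ∉ D n) :
    Tiles M₁ L (fun n => (D n)ᶜ) :=
  tiles_of_layers (Z := fun m => (D m)ᶜ) hM₁ (by omega) (layers_of_admissibleCubes hdvd hcubes)
    (cover_of_exhaustive (Z := fun m => (D m)ᶜ) (by show (D 0)ᶜ = ∅; rw [h0, Set.compl_univ])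
      fun x => by obtain ⟨n, hn⟩ := hex x; exact ⟨n, hn⟩)

/-- **(2.61) for the touching-cube geometry over ANY admissible sequence** (r11's separation property `hdistD` = [III] (2.13)
*«dist(Ω_n, Ω^c_{n−1}) ≧ LⁿξM₁»*, cube unions, `Ω₀ = T`, termination; `M ≥ M₁ ≥ 1`, `M₁ ∣ M`, `L ≥ 1`): `RowSum (touchGeo M₁ L
Ωᶜ F …) σ (K261 N d L 1 σ)` for `N ≥ 1`, `N + 1 ≤ L·(M/M₁)`, `e^{−σ}·L^{2d/N} < 1` — `Monotone`/`LayerSepZd` by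
`B15Ineq147Admissible`, `Tiles` by `tiles_of_admissible`. [cite: Balaban1984PropagatorsII, Lemma 2.1 (2.61) p.234, (2.1)–(2.4) p.224; Balaban1988Convergent, (2.13) p.256; Balaban1989LargeFieldI, p.179] -/
theorem rowSum_admissible {N : ℕ} {σ : ℝ}
    (hdistD : ∀ n, ∀ x ∈ D (n + 1), ∀ y, Within ((B14.Eq213MaximalDomains.side L M (n + 1) : ℤ) - 1) x y → y ∈ D n)
    (hcubes : ∀ n, IsUnionOfCubes (B14.Eq213MaximalDomains.side L M n) (D n)) (h0 : D 0 = Set.univ) (hex : ∀ x, ∃ n, x ∉ D n)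
    (hM₁ : 0 < M₁) (hM : 1 ≤ M) (hdvd : M₁ ∣ M) (hL : 1 ≤ L) (hN : 0 < N) (hNgap : N + 1 ≤ L * (M / M₁))
    (F : Finset (CubeSite M₁ L (fun n => (D n)ᶜ))) (kk : ℕ) (η R Mr : ℝ)
    (hθ : Real.exp (-σ) * (L : ℝ) ^ ((2 * d : ℝ) / N) < 1) :
    RowSum (touchGeo M₁ L (fun n => (D n)ᶜ) F kk η R Mr) σ (K261 N d L 1 σ) :=
  rowSum_touchGeo F kk η R Mr (monotone_compl_of_admissible hL hM hdistD) (layerSepZd_of_admissible hdistD)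
    (tiles_of_admissible hM₁ hL hdvd hcubes h0 hex) hM₁ hL hN hNgap hθ

/-- **Lemma 2.1 (2.60)–(2.63) for the touching-cube geometry over ANY admissible sequence** completed to the whole lattice:
hypotheses = r11's admissibility data (`hdistD`, cube unions), `Ω₀ = T`, termination, and the numerics (`M ≥ M₁ ≥ 1`,
`M₁ ∣ M`, `L ≥ 1`, `N ≥ 1`, `N + 1 ≤ L·(M/M₁)`, `R·M_r ≤ N`, `δ₀ ≥ 0`, `0 ≤ α ≤ 1`, `e^{−αδ₀}·L^{2d/N} < 1`); constant
`K261 N d L 1 (αδ₀)`. [cite: Balaban1984PropagatorsII, Lemma 2.1 (2.60)–(2.63) p.234, (2.1)–(2.4) p.224; Balaban1988Convergent, (2.13) p.256; Balaban1989LargeFieldI, p.179] -/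
theorem lemma21_admissible {N : ℕ} {δ₀ α : ℝ}
    (hdistD : ∀ n, ∀ x ∈ D (n + 1), ∀ y, Within ((B14.Eq213MaximalDomains.side L M (n + 1) : ℤ) - 1) x y → y ∈ D n)
    (hcubes : ∀ n, IsUnionOfCubes (B14.Eq213MaximalDomains.side L M n) (D n)) (h0 : D 0 = Set.univ) (hex : ∀ x, ∃ n, x ∉ D n)
    (hM₁ : 0 < M₁) (hM : 1 ≤ M) (hdvd : M₁ ∣ M) (hL : 1 ≤ L) (hN : 0 < N) (hNgap : N + 1 ≤ L * (M / M₁))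
    (F : Finset (CubeSite M₁ L (fun n => (D n)ᶜ))) (kk : ℕ) (η R Mr : ℝ) (hRM : R * Mr ≤ N)
    (hδ₀ : 0 ≤ δ₀) (hα0 : 0 ≤ α) (hα1 : α ≤ 1)
    (hθ : Real.exp (-(α * δ₀)) * (L : ℝ) ^ ((2 * d : ℝ) / N) < 1) :
    B6RandomWalk.Ineq260 (touchGeo M₁ L (fun n => (D n)ᶜ) F kk η R Mr) δ₀ α ∧
      B6Lemma21Repaired.Ineq261With (K261 N d L 1 (α * δ₀)) (touchGeo M₁ L (fun n => (D n)ᶜ) F kk η R Mr) δ₀ α ∧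
      B6Lemma21Repaired.Ineq262With (K261 N d L 1 (α * δ₀)) (touchGeo M₁ L (fun n => (D n)ᶜ) F kk η R Mr) δ₀ α ∧
      B6Lemma21Repaired.Ineq263With (K261 N d L 1 (α * δ₀)) (touchGeo M₁ L (fun n => (D n)ᶜ) F kk η R Mr) δ₀ α :=
  lemma21_touchGeo F kk η R Mr (monotone_compl_of_admissible hL hM hdistD) (layerSepZd_of_admissible hdistD)
    (tiles_of_admissible hM₁ hL hdvd hcubes h0 hex) hM₁ hL hN hNgap hRM hδ₀ hα0 hα1 hθ

end Admissible

/-! ## §3. (B) The nested boxes `Z″_n` and their printed-shape properties -/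

/-- The half-widths `r_n = M₁·K·n·Lⁿ`. [cite: Balaban1989LargeFieldI, p.179] -/
def boxR (M₁ K L n : ℕ) : ℕ := M₁ * K * n * L ^ n

/-- **The nested boxes** `Z″_n = box r_n`, a concrete `Z″`-sequence of the shape of [IV] p. 179 on `ℤᵈ` (scales counted from
the bottom as in `B15Ineq147LevelGap`). [cite: Balaban1989LargeFieldI, p.179; Balaban1984PropagatorsII, (2.1)–(2.2) p.224] -/
def nestedZ (M₁ K L : ℕ) : ℕ → Set (Fin d → ℤ) := fun n => box (boxR M₁ K L n)

variable {M₁ K L : ℕ}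

/-- `r_n + M₁K·L^{n+1} ≤ r_{n+1}` (`L ≥ 1`): room for one separating layer. [cite: Balaban1989LargeFieldI, p.179] -/
theorem boxR_step (hL : 1 ≤ L) (n : ℕ) : boxR M₁ K L n + M₁ * K * L ^ (n + 1) ≤ boxR M₁ K L (n + 1) := by
  unfold boxR
  have hpow : L ^ n ≤ L ^ (n + 1) := pow_le_pow_right₀ hL (Nat.le_succ n)
  have h1 : M₁ * K * n * L ^ n ≤ M₁ * K * n * L ^ (n + 1) := Nat.mul_le_mul_left _ hpow
  have e : M₁ * K * (n + 1) * L ^ (n + 1) = M₁ * K * n * L ^ (n + 1) + M₁ * K * L ^ (n + 1) := by ring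
  omega

/-- The half-widths increase (`L ≥ 1`). [cite: Balaban1989LargeFieldI, p.179] -/
theorem boxR_mono (hL : 1 ≤ L) : Monotone (boxR M₁ K L) :=
  monotone_nat_of_le_succ fun n => le_trans (Nat.le_add_right _ _) (boxR_step hL n)

/-- Boxes are monotone in the half-width. [cite: Balaban1989LargeFieldI, p.179] -/
theorem box_mono {r r' : ℕ} (h : r ≤ r') : box (d := d) r ⊆ box r' := fun x hx μ =>
  ⟨by have := (hx μ).1; omega, by have := (hx μ).2; omega⟩

/-- **Nesting** *«Z″_k ⊃ Z″_{k−1} ⊃ …»* (from the bottom: `Z″_n ⊆ Z″_{n+1}`). [cite: Balaban1989LargeFieldI, (1.11) p.179] -/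
theorem monotone_nestedZ (hL : 1 ≤ L) : Monotone (nestedZ (d := d) M₁ K L) := fun _ _ h =>
  box_mono (boxR_mono hL h)

/-- **One separating layer** *«Z″_k, Z″_{k−1} are separated by one layer of M-cubes»*: `LayerSepZd (nestedZ M₁ K L) (M₁·K) L` —
a point of `Z″_n` and a point outside `Z″_{n+1}` differ by at least `r_{n+1} − r_n ≥ M₁K·L^{n+1}` in the coordinate where the
second point leaves the larger box (`L ≥ 1`). [cite: Balaban1989LargeFieldI, p.179] -/
theorem layerSepZd_nestedZ (hL : 1 ≤ L) : LayerSepZd (nestedZ (d := d) M₁ K L) (M₁ * K) L := by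
  intro n a b ha hb
  simp only [nestedZ, box, Set.mem_setOf_eq, not_forall] at hb
  obtain ⟨μ, hμ⟩ := hb
  have haμ := ha μ
  have hstep : ((boxR M₁ K L n : ℕ) : ℤ) + ((M₁ * K * L ^ (n + 1) : ℕ) : ℤ) ≤ ((boxR M₁ K L (n + 1) : ℕ) : ℤ) := by
    exact_mod_cast boxR_step hL n
  have hz : ((M₁ * K * L ^ (n + 1) : ℕ) : ℤ) ≤ |a μ - b μ| := by
    rcases le_or_gt (-((boxR M₁ K L (n + 1) : ℕ) : ℤ)) (b μ) with h | h
    · -- then `b μ ≥ r_{n+1}` (else `b` would satisfy the box condition at `μ`)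
      have hb' : ((boxR M₁ K L (n + 1) : ℕ) : ℤ) ≤ b μ := by
        by_contra hlt
        exact hμ ⟨h, not_le.mp hlt⟩
      rw [abs_sub_comm, abs_of_nonneg (by linarith [haμ.2])]
      linarith [haμ.2]
    · rw [abs_of_nonneg (by linarith [haμ.1])]
      linarith [haμ.1]
  have hr : ((M₁ * K : ℕ) : ℝ) * (L : ℝ) ^ (n + 1) ≤ |((a μ : ℤ) : ℝ) - ((b μ : ℤ) : ℝ)| := by exact_mod_cast hz
  calc ((M₁ * K : ℕ) : ℝ) * (L : ℝ) ^ (n + 1) ≤ |((a μ : ℤ) : ℝ) - ((b μ : ℤ) : ℝ)| := hr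
    _ = dist (toR a μ) (toR b μ) := by rw [Real.dist_eq]; rfl
    _ ≤ dist (toR a) (toR b) := dist_le_pi_dist (toR a) (toR b) μ

/-- **The layers are unions of cubes of the corresponding scale** *«Z″_{k−1}∖Z″_{k−2} are unions of L^{−1}M-cubes … and so
on»*: `Z″_{n+1}∖Z″_n` is a union of `M₁Lⁿ`-cubes (both half-widths are multiples of `M₁Lⁿ`; `M₁ ≥ 1`, `L ≥ 1`).
[cite: Balaban1989LargeFieldI, p.179] -/
theorem layers_nestedZ (hM₁ : 0 < M₁) (hL : 1 ≤ L) (n : ℕ) :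
    IsUnionOfCubes (M₁ * L ^ n) (nestedZ (d := d) M₁ K L (n + 1) \ nestedZ M₁ K L n) := by
  have hs : 0 < M₁ * L ^ n := Nat.mul_pos hM₁ (Nat.pow_pos (by omega))
  have e1 : boxR M₁ K L (n + 1) = (M₁ * L ^ n) * (K * (n + 1) * L) := by unfold boxR; ring
  have e0 : boxR M₁ K L n = (M₁ * L ^ n) * (K * n) := by unfold boxR; ring
  unfold nestedZ
  rw [e1, e0]
  exact isUnionOfCubes_diff (isUnionOfCubes_box hs _) (isUnionOfCubes_box hs _)

/-- `Z″_0 = ∅` (`d ≥ 1`; *«Ω_j = T_η for j ≤ l»* at the bottom of the sequence). [cite: Balaban1984PropagatorsII, (2.1)–(2.4) p.224] -/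
theorem nestedZ_zero (hd : 0 < d) : nestedZ (d := d) M₁ K L 0 = ∅ := by
  ext x
  simp only [nestedZ, boxR, box, Set.mem_setOf_eq, Set.mem_empty_iff_false, iff_false, not_forall]
  refine ⟨⟨0, hd⟩, fun h => ?_⟩
  simp at h
  omega

/-- The boxes exhaust `ℤᵈ` (`M₁, K, L ≥ 1`: `r_n ≥ n`). [cite: Balaban1984PropagatorsII, (2.4) p.224] -/
theorem exhaustive_nestedZ (hM₁ : 0 < M₁) (hK : 0 < K) (hL : 1 ≤ L) (x : Fin d → ℤ) :
    ∃ n, x ∈ nestedZ M₁ K L n := by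
  refine ⟨∑ ν, (x ν).natAbs + 1, fun μ => ?_⟩
  set n := ∑ ν, (x ν).natAbs + 1 with hn
  have hμ : (x μ).natAbs ≤ ∑ ν, (x ν).natAbs :=
    Finset.single_le_sum (f := fun ν => (x ν).natAbs) (fun _ _ => Nat.zero_le _) (Finset.mem_univ μ)
  have hrn : n ≤ boxR M₁ K L n := by
    unfold boxR
    have h1 : 1 ≤ M₁ * K := Nat.mul_pos hM₁ hK
    have h2 : 1 ≤ L ^ n := Nat.pow_pos (by omega)
    calc n = 1 * n * 1 := by ring
      _ ≤ M₁ * K * n * L ^ n := Nat.mul_le_mul (Nat.mul_le_mul_right _ h1) h2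
  have habs : ((x μ).natAbs : ℤ) = |x μ| := Int.natCast_natAbs (x μ)
  have hlt : |x μ| < (boxR M₁ K L n : ℤ) := by
    rw [← habs]
    have : (x μ).natAbs < boxR M₁ K L n := by omega
    exact_mod_cast this
  constructor
  · linarith [neg_abs_le (x μ)]
  · linarith [le_abs_self (x μ)]

/-- **The covering (2.4) for the nested boxes**: every lattice point lies in the cube of a cube-site (`d, M₁, K ≥ 1`, `L ≥ 1`).
[cite: Balaban1984PropagatorsII, (2.4) p.224; Balaban1989LargeFieldI, p.179] -/
theorem tiles_nestedZ (hd : 0 < d) (hM₁ : 0 < M₁) (hK : 0 < K) (hL : 1 ≤ L) : Tiles M₁ L (nestedZ (d := d) M₁ K L) :=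
  tiles_of_layers hM₁ (by omega) (layers_nestedZ hM₁ hL)
    (cover_of_exhaustive (nestedZ_zero hd) (exhaustive_nestedZ hM₁ hK hL))

/-- The touching-cube graph of the nested boxes is connected. [cite: Balaban1984PropagatorsII, (2.4) p.224, (2.46) p.231] -/
theorem connected_nestedZ (hd : 0 < d) (hM₁ : 0 < M₁) (hK : 0 < K) (hL : 1 ≤ L) :
    (touchC M₁ L (nestedZ (d := d) M₁ K L)).Connected :=
  touchC_connected (tiles_nestedZ hd hM₁ hK hL) hM₁ (by omega)

/-- The walk form of (2.2)/(2.57) for the nested boxes: `LevelGap … zoneC (L·K − 1)` — every chain of touching cubes across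
one level has at least `L·K` bonds (`M₁ ≥ 1`, `L ≥ 1`). [cite: Balaban1984PropagatorsII, (2.2) p.224, (2.57) p.233; Balaban1989LargeFieldI, p.179] -/
theorem levelGap_nestedZ (hM₁ : 0 < M₁) (hL : 1 ≤ L) :
    LevelGap (touchC M₁ L (nestedZ (d := d) M₁ K L)) zoneC (L * K - 1) := by
  have h := levelGap_touchC_sharp (Z := nestedZ (d := d) M₁ K L) (M := M₁ * K) (monotone_nestedZ hL)
    (layerSepZd_nestedZ hL) hM₁ hL
  rwa [Nat.mul_div_cancel_left K hM₁] at h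

/-! ## §4. Lemma 2.1 for the touching-cube geometry over the nested boxes: numerics only -/

/-- **(2.61) for the touching-cube geometry over the nested boxes** — every geometric hypothesis discharged: for any finite
set `F` of cube-sites, `RowSum (touchGeo M₁ L (nestedZ M₁ K L) F …) σ (K261 N d L 1 σ)` from the numerics alone
(`d, M₁, K ≥ 1`, `L ≥ 1`, `N ≥ 1`, `N + 1 ≤ L·K`, `e^{−σ}·L^{2d/N} < 1`). [cite: Balaban1984PropagatorsII, Lemma 2.1 (2.61) p.234; Balaban1989LargeFieldI, p.179, p.186] -/
theorem rowSum_nestedBoxes {N : ℕ} {σ : ℝ} (hd : 0 < d) (hM₁ : 0 < M₁) (hK : 0 < K) (hL : 1 ≤ L) (hN : 0 < N)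
    (hNK : N + 1 ≤ L * K) (F : Finset (CubeSite M₁ L (nestedZ (d := d) M₁ K L))) (kk : ℕ) (η R Mr : ℝ)
    (hθ : Real.exp (-σ) * (L : ℝ) ^ ((2 * d : ℝ) / N) < 1) :
    RowSum (touchGeo M₁ L (nestedZ M₁ K L) F kk η R Mr) σ (K261 N d L 1 σ) :=
  rowSum_touchGeo F kk η R Mr (monotone_nestedZ hL) (layerSepZd_nestedZ hL) (tiles_nestedZ hd hM₁ hK hL) hM₁ hL hN
    (by rwa [Nat.mul_div_cancel_left K hM₁]) hθ

/-- **Lemma 2.1 (2.60)–(2.63) for the touching-cube geometry over the nested boxes — NON-VACUITY OF THE WHOLE CHAIN**: for any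
finite set `F` of cube-sites of `nestedZ M₁ K L` and parameters with `R·M_r ≤ N`, all four displays hold with the constant
`K261 N d L 1 (αδ₀)`, the hypotheses being ONLY numerical (`d, M₁, K ≥ 1`, `L ≥ 1`, `N ≥ 1`, `N + 1 ≤ L·K`, `δ₀ ≥ 0`,
`0 ≤ α ≤ 1`, `e^{−αδ₀}·L^{2d/N} < 1`). [cite: Balaban1984PropagatorsII, Lemma 2.1 (2.60)–(2.63) p.234; Balaban1989LargeFieldI, p.179, p.186] -/
theorem lemma21_nestedBoxes {N : ℕ} {δ₀ α : ℝ} (hd : 0 < d) (hM₁ : 0 < M₁) (hK : 0 < K) (hL : 1 ≤ L) (hN : 0 < N)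
    (hNK : N + 1 ≤ L * K) (F : Finset (CubeSite M₁ L (nestedZ (d := d) M₁ K L))) (kk : ℕ) (η R Mr : ℝ)
    (hRM : R * Mr ≤ N) (hδ₀ : 0 ≤ δ₀) (hα0 : 0 ≤ α) (hα1 : α ≤ 1)
    (hθ : Real.exp (-(α * δ₀)) * (L : ℝ) ^ ((2 * d : ℝ) / N) < 1) :
    B6RandomWalk.Ineq260 (touchGeo M₁ L (nestedZ M₁ K L) F kk η R Mr) δ₀ α ∧
      B6Lemma21Repaired.Ineq261With (K261 N d L 1 (α * δ₀)) (touchGeo M₁ L (nestedZ M₁ K L) F kk η R Mr) δ₀ α ∧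
      B6Lemma21Repaired.Ineq262With (K261 N d L 1 (α * δ₀)) (touchGeo M₁ L (nestedZ M₁ K L) F kk η R Mr) δ₀ α ∧
      B6Lemma21Repaired.Ineq263With (K261 N d L 1 (α * δ₀)) (touchGeo M₁ L (nestedZ M₁ K L) F kk η R Mr) δ₀ α :=
  lemma21_touchGeo F kk η R Mr (monotone_nestedZ hL) (layerSepZd_nestedZ hL) (tiles_nestedZ hd hM₁ hK hL) hM₁ hL hN
    (by rwa [Nat.mul_div_cancel_left K hM₁]) hRM hδ₀ hα0 hα1 hθ

end Literature.MathematicalPhysics.QuantumFieldTheory.Balaban1983to89.B15TouchingCubeDomains
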